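import Literature.AnabelianGeometry.SemiGraphs.TemperedFibreProduct
import Literature.IUT.HodgeTheaters.ProfiniteCompletionNormalizers
import Literature.GroupTheory.CombinatorialGroupTheory.FreeGroupCentralizers
import Literature.AlgebraicGeometry.Frobenioids.Categories
import Mathlib.Tactic.Group
import HarnessLib

/-!
# The tempered model group `Γ = F̂₂ ×_{Ẑ} ℤ` is SLIM — [SemiAnbd] Ex. 3.10 "temp-slim", model case

Mochizuki, *Semi-graphs of anabelioids*, Publ. RIMS **42** (2006) [SemiAnbd], Example 3.10 p. 45
("we thus conclude that both `Δ` and `Π` are temp-slim"), §0 / [FrdI] §0 p. 13 ("slim": every open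
subgroup has trivial centraliser); [EtTh] §1 p. 12. abc-iut cell, wave-5 prover seat abc-iut-w5-d218
(gen 2); vacuity lane, part C of the kernel inhabitant of the L3 interface `OncePuncturedTemperedGroup`
(`TemperedCurves.lean`). PROOF-ONLY, hypothesis-parametrised (no definition, no instance, no named fact).

SETTING. `F₂ = FreeGroup (Fin 2)` with free generators `a = of 0`, `b = of 1`; `F̂₂`, `Ẑ` the profinite
completions (abc-iut-L5-t1's `profiniteCompletion`, `toCompletion = η`, `ι`); exponent sums
`σa, σb : F₂ → ℤ`; continuous homomorphisms `e, êb : F̂₂ → Ẑ` completing `σa, σb`, and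
`îa, îb : Ẑ → F̂₂` completing `k ↦ a^k`, `k ↦ b^k`; `Γ ≤ F̂₂ × ℤ` the fibre product `{(x,n) | e x = ι n}`.
RESULT `isSlimGroup`: **`Γ` is slim.** An open `U ≤ Γ` contains a slice `(V × 0) ∩ Γ` (part A), hence the
elements `(η b^m, 0)` and `(η(a b^m a⁻¹), 0)` for `m = [F₂ : η⁻¹V]`; a centralising `(z, n)` then has
`z ∈ C_{F̂₂}(η b^m) = cl η⟨b⟩` — the CENTRALISER CONDITION for free groups in their profinite completion
(abc-iut-L5-d2 `centralizer_toCompletion_eq_closure_of_isFreeGroup'`, via the tree's conjugacy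
separability of free groups, + `FreeGroup.centralizer_zpow_eq_zpowers`, Magnus–Karrass–Solitar 4.1.6)
— and likewise `(η a)⁻¹ z (η a) ∈ cl η⟨b⟩`; evaluating `êb` (which kills `η a` and splits `îb`) gives
`z = (η a)⁻¹ z (η a)`, so `z ∈ C(η a) = cl η⟨a⟩`; evaluating `e` (which splits `îa` and kills `cl η⟨b⟩`)
gives `z = 1`; finally `ι n = e 1 = 1` forces `n = 0`.
HONEST FRAMING: classical combinatorial/profinite group theory; nothing of [SemiAnbd]/[EtTh] is
asserted; no side is taken on any disputed claim.
-/

noncomputable section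

open Topology Filter Set Function
open Literature.IUT.HodgeTheaters (profiniteCompletion toCompletion)
open Literature.AlgebraicGeometry.Frobenioids (IsSlimGroup)
open Literature.GroupTheory.CombinatorialGroupTheory

namespace Literature.AnabelianGeometry.SemiGraphs

namespace TemperedFibreProduct

/-! ### Free generators are not proper powers; centralisers of their powers in `F̂` -/

/-- A free generator `of i` of a free group is not a proper power: `t ^ k = of i` with `k : ℕ` forces
`k = 1` (apply the exponent-sum `F → ℤ` at `i`). [cite: MagnusKarrassSolitar1966, Cor. 4.1.6] -/
theorem eq_one_of_pow_eq_of {ι' : Type*} [DecidableEq ι'] (i : ι') (t : FreeGroup ι') (k : ℕ)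
    (h : t ^ k = FreeGroup.of i) : k = 1 := by
  let σ : FreeGroup ι' →* Multiplicative ℤ :=
    FreeGroup.lift fun j => if j = i then Multiplicative.ofAdd (1 : ℤ) else 1
  have hσ : σ (FreeGroup.of i) = Multiplicative.ofAdd 1 := by simp [σ]
  have h1 := congrArg (fun x => (σ x).toAdd) h
  simp only [map_pow, toAdd_pow, hσ, toAdd_ofAdd, nsmul_eq_mul] at h1
  have hk : (k : ℤ) ∣ 1 := ⟨(σ t).toAdd, h1.symm⟩
  have := Int.eq_one_of_dvd_one (by positivity) hk
  exact_mod_cast this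

/-- **Centraliser of a nonzero power of a free generator in the profinite completion**: for
`F = FreeGroup (Fin 2)` (indeed any free group, here the case needed) and `m ≠ 0`,
`C_{F̂}(η (of i)^m) ⊆ closure (η ⟨of i⟩)` — abc-iut-L5-d2's centraliser condition
`C_{F̂}(η g) = cl η C_F(g)` (conjugacy separability of free groups) combined with
`C_F((of i)^m) = ⟨of i⟩` (Magnus–Karrass–Solitar 4.1.6, tree `FreeGroup.centralizer_zpow_eq_zpowers`).
[cite: MagnusKarrassSolitar1966, Cor. 4.1.6] -/
theorem centralizer_eta_of_zpow_subset (i : Fin 2) {m : ℤ} (hm : m ≠ 0) :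
    (Subgroup.centralizer
        ({toCompletion (FreeGroup (Fin 2)) (FreeGroup.of i ^ m)} :
          Set (profiniteCompletion (FreeGroup (Fin 2)))) : Set _) ⊆
      closure (toCompletion (FreeGroup (Fin 2)) ''
        (Subgroup.zpowers (FreeGroup.of i) : Set (FreeGroup (Fin 2)))) := by
  haveI : IsFreeGroup (⊤ : Subgroup (FreeGroup (Fin 2))) :=
    IsFreeGroup.ofMulEquiv (Subgroup.topEquiv (G := FreeGroup (Fin 2))).symm
  rw [Literature.IUT.HodgeTheaters.ProfiniteCompletion.centralizer_toCompletion_eq_closure_of_isFreeGroup'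
    (F := FreeGroup (Fin 2)) ⊤ inferInstance (g := FreeGroup.of i ^ m) (Subgroup.mem_top _),
    FreeGroup.centralizer_zpow_eq_zpowers (fun t k h => eq_one_of_pow_eq_of i t k h) hm]

/-- The closure of `η ⟨g⟩` lies in the range of any continuous homomorphism `î : Ẑ → F̂` completing
`k ↦ g^k` (the range of `î` is compact, hence closed). [cite: MochizukiSemiAnbd2006, §6 p.69] -/
theorem closure_eta_zpowers_subset_range {F : Type} [Group F] (g : F)
    (î : profiniteCompletion (Multiplicative ℤ) →ₜ* profiniteCompletion F)
    (hî : ∀ k : ℤ, î (toCompletion (Multiplicative ℤ) (Multiplicative.ofAdd k)) = toCompletion F (g ^ k)) :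
    closure (toCompletion F '' (Subgroup.zpowers g : Set F)) ⊆ Set.range î := by
  refine closure_minimal ?_ (isCompact_range (map_continuous î)).isClosed
  rintro _ ⟨x, hx, rfl⟩
  obtain ⟨k, rfl⟩ := Subgroup.mem_zpowers_iff.mp hx
  exact ⟨_, hî k⟩

/-! ### Slimness of the fibre product over `F̂₂` -/

variable (e êb : profiniteCompletion (FreeGroup (Fin 2)) →ₜ* profiniteCompletion (Multiplicative ℤ))
  (îa îb : profiniteCompletion (Multiplicative ℤ) →ₜ* profiniteCompletion (FreeGroup (Fin 2)))
  (σa σb : FreeGroup (Fin 2) →* Multiplicative ℤ)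
  (hσaa : σa (FreeGroup.of 0) = Multiplicative.ofAdd 1) (hσab : σa (FreeGroup.of 1) = 1)
  (hσba : σb (FreeGroup.of 0) = 1) (hσbb : σb (FreeGroup.of 1) = Multiplicative.ofAdd 1)
  (he : ∀ g, e (toCompletion _ g) = toCompletion _ (σa g))
  (hêb : ∀ g, êb (toCompletion _ g) = toCompletion _ (σb g))
  (hîa : ∀ k : ℤ, îa (toCompletion _ (Multiplicative.ofAdd k)) = toCompletion _ (FreeGroup.of 0 ^ k))
  (hîb : ∀ k : ℤ, îb (toCompletion _ (Multiplicative.ofAdd k)) = toCompletion _ (FreeGroup.of 1 ^ k))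
  (hιinj : Injective (toCompletion (Multiplicative ℤ)))
  (Γ : Subgroup (profiniteCompletion (FreeGroup (Fin 2)) × Multiplicative ℤ))
  (hΓ : ∀ p, p ∈ Γ ↔ e p.1 = toCompletion (Multiplicative ℤ) p.2)

/-- `ê ∘ î = id` on `Ẑ` when `ê` completes `σ` and `î` completes `k ↦ g^k` with `σ g = 1 ∈ ℤ`
(additively): both sides are continuous homomorphisms agreeing on the dense image of `ℤ`.
[cite: MochizukiSemiAnbd2006, §6 p.69] -/
theorem apply_apply_eq_self_of {F : Type} [Group F] (g : F) (σ : F →* Multiplicative ℤ)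
    (hσ : σ g = Multiplicative.ofAdd 1)
    (ê : profiniteCompletion F →ₜ* profiniteCompletion (Multiplicative ℤ))
    (î : profiniteCompletion (Multiplicative ℤ) →ₜ* profiniteCompletion F)
    (hê : ∀ x, ê (toCompletion _ x) = toCompletion _ (σ x))
    (hî : ∀ k : ℤ, î (toCompletion _ (Multiplicative.ofAdd k)) = toCompletion F (g ^ k))
    (t : profiniteCompletion (Multiplicative ℤ)) : ê (î t) = t := by
  have hd : DenseRange (toCompletion (Multiplicative ℤ)) :=
    ProfiniteGrp.ProfiniteCompletion.denseRange (GrpCat.of (Multiplicative ℤ))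
  have key : (fun t => ê (î t)) = id := by
    refine hd.equalizer ((map_continuous ê).comp (map_continuous î)) continuous_id ?_
    funext k
    simp only [Function.comp_apply, id_eq]
    have hk : k = Multiplicative.ofAdd k.toAdd := rfl
    rw [hk, hî, hê, map_zpow, hσ, ← ofAdd_zsmul, smul_eq_mul, mul_one]
  exact congrFun key t

/-- `ê ∘ î = 1` on `Ẑ` when `ê` completes `σ` and `î` completes `k ↦ g^k` with `σ g = 0 ∈ ℤ`.
[cite: MochizukiSemiAnbd2006, §6 p.69] -/
theorem apply_apply_eq_one_of {F : Type} [Group F] (g : F) (σ : F →* Multiplicative ℤ)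
    (hσ : σ g = 1)
    (ê : profiniteCompletion F →ₜ* profiniteCompletion (Multiplicative ℤ))
    (î : profiniteCompletion (Multiplicative ℤ) →ₜ* profiniteCompletion F)
    (hê : ∀ x, ê (toCompletion _ x) = toCompletion _ (σ x))
    (hî : ∀ k : ℤ, î (toCompletion _ (Multiplicative.ofAdd k)) = toCompletion F (g ^ k))
    (t : profiniteCompletion (Multiplicative ℤ)) : ê (î t) = 1 := by
  have hd : DenseRange (toCompletion (Multiplicative ℤ)) :=
    ProfiniteGrp.ProfiniteCompletion.denseRange (GrpCat.of (Multiplicative ℤ))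
  have key : (fun t => ê (î t)) = fun _ => 1 := by
    refine hd.equalizer ((map_continuous ê).comp (map_continuous î)) continuous_const ?_
    funext k
    simp only [Function.comp_apply]
    have hk : k = Multiplicative.ofAdd k.toAdd := rfl
    rw [hk, hî, hê, map_zpow, hσ, one_zpow, map_one]
  exact congrFun key t

include hσaa hσab hσba hσbb he hêb hîa hîb hιinj hΓ in
/-- **The tempered model group `Γ = F̂₂ ×_{Ẑ} ℤ` is slim**: every open subgroup `U ≤ Γ` has trivial
centraliser ([SemiAnbd] Ex. 3.10 p. 45 "temp-slim", here for the model; see the module docstring for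
the argument: slices `(V × 0) ∩ Γ ⊆ U`, test elements `(η b^m, 0)`, `(η(ab^ma⁻¹), 0)`, the centraliser
condition in `F̂₂`, and the evaluations `êb`, `e`). [cite: MochizukiSemiAnbd2006, Ex 3.10 p.45] -/
theorem isSlimGroup : IsSlimGroup Γ := by
  classical
  refine ⟨fun U hU => ?_⟩
  refine (Subgroup.eq_bot_iff_forall _).mpr fun q hq => ?_
  -- notation
  let a : FreeGroup (Fin 2) := FreeGroup.of 0
  let b : FreeGroup (Fin 2) := FreeGroup.of 1
  let η := toCompletion (FreeGroup (Fin 2))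
  let ι := toCompletion (Multiplicative ℤ)
  -- a slice `N_V ⊆ U`
  obtain ⟨V, N, -, hN, hNU⟩ := exists_openNormal_le_of_mem_nhds Γ (hU.mem_nhds U.one_mem)
  haveI : V.toSubgroup.Normal := V.isNormal'
  -- `M := η⁻¹ V ⊴ F₂` of finite index `m`; `b^m ∈ M`, `a b^m a⁻¹ ∈ M`
  let M : Subgroup (FreeGroup (Fin 2)) := V.toSubgroup.comap η
  haveI : M.Normal := Subgroup.Normal.comap inferInstance _
  haveI hVfi : V.toSubgroup.FiniteIndex := by
    haveI : Finite (profiniteCompletion (FreeGroup (Fin 2)) ⧸ V.toSubgroup) := inferInstance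
    exact Subgroup.finiteIndex_of_finite_quotient
  have hMfi : M.FiniteIndex := by
    refine ⟨fun h0 => ?_⟩
    have hd := Subgroup.relIndex_dvd_index_of_normal V.toSubgroup η.range
    rw [← Subgroup.index_comap] at hd
    exact hVfi.index_ne_zero (Nat.eq_zero_of_zero_dvd (h0 ▸ hd))
  let m : ℤ := M.index
  have hm : m ≠ 0 := by
    change (M.index : ℤ) ≠ 0
    exact_mod_cast hMfi.index_ne_zero
  have hbm : b ^ m ∈ M := by
    change b ^ ((M.index : ℕ) : ℤ) ∈ M
    rw [zpow_natCast]; exact M.pow_index_mem b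
  have habm : a * b ^ m * a⁻¹ ∈ M := Subgroup.Normal.conj_mem inferInstance _ hbm a
  have hσbm : σa (b ^ m) = 1 := by rw [map_zpow, hσab, one_zpow]
  have hσabm : σa (a * b ^ m * a⁻¹) = 1 := by
    rw [map_mul, map_mul, map_inv, hσbm, mul_one, mul_inv_cancel]
  -- the two test elements of `U`
  have hw₁Γ : ((η (b ^ m), (1 : Multiplicative ℤ)) : _ × Multiplicative ℤ) ∈ Γ := by
    rw [hΓ]; change e (η (b ^ m)) = ι 1; rw [he, hσbm]
  have hw₂Γ : ((η (a * b ^ m * a⁻¹), (1 : Multiplicative ℤ)) : _ × Multiplicative ℤ) ∈ Γ := by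
    rw [hΓ]; change e (η (a * b ^ m * a⁻¹)) = ι 1; rw [he, hσabm]
  have hw₁U : (⟨_, hw₁Γ⟩ : Γ) ∈ U := hNU ((hN _).mpr ⟨hbm, rfl⟩)
  have hw₂U : (⟨_, hw₂Γ⟩ : Γ) ∈ U := hNU ((hN _).mpr ⟨habm, rfl⟩)
  -- `q = (z, n)` commutes with both
  obtain ⟨⟨z, n⟩, hzn⟩ := q
  have hc₁ : η (b ^ m) * z = z * η (b ^ m) := by
    have := Subgroup.mem_centralizer_iff.mp hq _ hw₁U
    exact congrArg (fun r : Γ => (r : profiniteCompletion (FreeGroup (Fin 2)) × Multiplicative ℤ).1) this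
  have hc₂ : η (a * b ^ m * a⁻¹) * z = z * η (a * b ^ m * a⁻¹) := by
    have := Subgroup.mem_centralizer_iff.mp hq _ hw₂U
    exact congrArg (fun r : Γ => (r : profiniteCompletion (FreeGroup (Fin 2)) × Multiplicative ℤ).1) this
  -- hence `z ∈ cl η⟨b⟩ ⊆ range îb` and `(η a)⁻¹ z (η a) ∈ cl η⟨b⟩ ⊆ range îb`
  have hB : ∀ y : profiniteCompletion (FreeGroup (Fin 2)), η (b ^ m) * y = y * η (b ^ m) → ∃ t, îb t = y := by
    intro y hy
    have hy' : y ∈ Subgroup.centralizer ({η (b ^ m)} : Set (profiniteCompletion (FreeGroup (Fin 2)))) :=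
      Subgroup.mem_centralizer_singleton_iff.mpr hy.symm
    exact closure_eta_zpowers_subset_range b îb hîb (centralizer_eta_of_zpow_subset 1 hm hy')
  obtain ⟨t, ht⟩ := hB z hc₁
  have hc₂' : η (b ^ m) * ((η a)⁻¹ * z * η a) = ((η a)⁻¹ * z * η a) * η (b ^ m) := by
    rw [map_mul, map_mul, map_inv] at hc₂
    have h3 := congrArg (fun w => (η a)⁻¹ * w * η a) hc₂
    calc η (b ^ m) * ((η a)⁻¹ * z * η a)
        = (η a)⁻¹ * (η a * η (b ^ m) * (η a)⁻¹ * z) * η a := by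
          simp only [mul_assoc, inv_mul_cancel_left]
      _ = (η a)⁻¹ * (z * (η a * η (b ^ m) * (η a)⁻¹)) * η a := by rw [h3]
      _ = ((η a)⁻¹ * z * η a) * η (b ^ m) := by
          simp only [mul_assoc, inv_mul_cancel, mul_one]
  obtain ⟨t', ht'⟩ := hB _ hc₂'
  -- evaluate `êb`: `êb (η a) = 1`, `êb ∘ îb = id` ⇒ `t = t'` ⇒ `z` commutes with `η a`
  have hêba : êb (η a) = 1 := by rw [hêb, hσba]; exact map_one _
  have ht_eq : t = t' := by
    have h1 : êb z = t := by rw [← ht]; exact apply_apply_eq_self_of b σb hσbb êb îb hêb hîb t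
    have h2 : êb ((η a)⁻¹ * z * η a) = t' := by
      rw [← ht']; exact apply_apply_eq_self_of b σb hσbb êb îb hêb hîb t'
    rw [map_mul, map_mul, map_inv, hêba, inv_one, one_mul, mul_one, h1] at h2
    exact h2
  have hza : η a * z = z * η a := by
    have h4 : (η a)⁻¹ * z * η a = z := by rw [← ht', ← ht_eq, ht]
    calc η a * z = η a * ((η a)⁻¹ * z * η a) := by rw [h4]
      _ = z * η a := by simp only [mul_assoc, mul_inv_cancel_left]
  -- `z ∈ C(η a) = cl η⟨a⟩ ⊆ range îa`
  have hA : ∃ u, îa u = z := by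
    have hz' : z ∈ Subgroup.centralizer ({η (a ^ (1 : ℤ))} : Set (profiniteCompletion (FreeGroup (Fin 2)))) := by
      rw [zpow_one]; exact Subgroup.mem_centralizer_singleton_iff.mpr hza.symm
    exact closure_eta_zpowers_subset_range a îa hîa (centralizer_eta_of_zpow_subset 0 one_ne_zero hz')
  obtain ⟨u, hu⟩ := hA
  -- evaluate `e`: `e ∘ îa = id`, `e ∘ îb = 1` ⇒ `u = 1` ⇒ `z = 1`
  have hu1 : u = 1 := by
    have h1 : e z = u := by rw [← hu]; exact apply_apply_eq_self_of a σa hσaa e îa he hîa u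
    have h2 : e z = 1 := by rw [← ht]; exact apply_apply_eq_one_of b σa hσab e îb he hîb t
    rw [h1] at h2; exact h2
  have hz1 : z = 1 := by rw [← hu, hu1, map_one]
  -- and `n = 0`
  have hn1 : n = 1 := by
    have h := (hΓ _).mp hzn
    change e z = ι n at h
    rw [hz1, map_one] at h
    exact hιinj (by rw [map_one]; exact h.symm)
  subst hz1; subst hn1
  rfl

end TemperedFibreProduct

end Literature.AnabelianGeometry.SemiGraphs

end
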